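import Summits.QuantumFields.QCD.Theses.HeatSlicedQuarks

/-!
# Stub `stub_squareRootStrip` of line `Sketch`
(crux `Summit.QuantumFields.QCD.Theses.HeatSlicedQuarks.InterleavedHeatSliceFlow`, item stmt-QuantumFields-8891)

**The square-root strip** (card square-root-dissipativity-strips; the consumer of
`stub_squareDissipativity` inside the engine).  Lumer–Phillips in `ℓ²(ι)`, `ι` finite: if the
quadratic form of a complex square matrix `M` satisfies

  `Re Σ_i conj(v i) · (M v) i ≥ -c² Σ_i ‖v i‖²`  for every `v`,

then the semigroup `e^{-sM}` is quasi-contractive,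

  `Σ_i ‖(e^{-sM} v) i‖² ≤ e^{2 c² s} Σ_i ‖v i‖²`  for every `s ≥ 0` and every `v`.

Proof (energy method).  Put `u(t) = exp(t • (-M)) v`.  The matrix exponential along a real ray has
derivative `(-M) exp(t • (-M))` (`hasDerivAt_exp_smul_const'`, in the `L^∞` operator normed algebra
structure `Matrix.Norms.Operator`; the exponential itself does not depend on the norm), so entrywise
`u' = -M u`.  The energy `E(t) = Σ_i ‖u(t) i‖²` then has `E' = 2 Re⟨u, u'⟩ = -2 Re⟨u, M u⟩ ≤ 2c² E`,
whence `t ↦ e^{-2c² t} E(t)` has non-positive derivative and is antitone, giving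
`E(s) ≤ e^{2c² s} E(0) = e^{2c² s} Σ_i ‖v i‖²` for `s ≥ 0`.  Finally `s • (-M) = (-(s : ℂ)) • M`.
No named facts are used (Mathlib only).
-/

namespace Summit.QuantumFields.QCD.Cruxes.InterleavedHeatSliceFlow.Sketch

open Matrix
open scoped Matrix

/-- Grönwall in its simplest form: if `E' ≤ k E` everywhere on `ℝ`, then
`E s ≤ e^{k s} E 0` for `s ≥ 0` (the function `t ↦ e^{-k t} E t` is antitone). -/
private theorem squareRootStrip_gronwall (E E' : ℝ → ℝ) (k : ℝ)
    (hE : ∀ t, HasDerivAt E (E' t) t) (hE' : ∀ t, E' t ≤ k * E t) (s : ℝ) (hs : 0 ≤ s) :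
    E s ≤ Real.exp (k * s) * E 0 := by
  have hg : ∀ t, HasDerivAt (fun t => Real.exp (-(k * t)) * E t)
      (Real.exp (-(k * t)) * -(k * 1) * E t + Real.exp (-(k * t)) * E' t) t := fun t =>
    (((hasDerivAt_id' t).const_mul k).fun_neg.exp).fun_mul (hE t)
  have hanti : Antitone fun t => Real.exp (-(k * t)) * E t := by
    refine antitone_of_hasDerivAt_nonpos hg fun t => ?_
    show Real.exp (-(k * t)) * -(k * 1) * E t + Real.exp (-(k * t)) * E' t ≤ 0
    have hpos : 0 < Real.exp (-(k * t)) := Real.exp_pos _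
    have h1 := mul_le_mul_of_nonneg_left (hE' t) hpos.le
    nlinarith [h1]
  have h := hanti hs
  simp only [mul_zero, neg_zero, Real.exp_zero, one_mul] at h
  rwa [Real.exp_neg, inv_mul_le_iff₀ (Real.exp_pos _)] at h

/-- Derivative of the energy `t ↦ Σ_i ‖u t i‖²` of a coordinatewise differentiable curve
`u : ℝ → ι → ℂ`: it is `2 Re⟨u t, u'⟩ = 2 Re (star (u t) ⬝ᵥ u')`. -/
private theorem squareRootStrip_hasDerivAt_energy {ι : Type*} [Fintype ι] (u : ℝ → ι → ℂ)
    (u' : ι → ℂ) (t : ℝ) (hu : ∀ i, HasDerivAt (fun t => u t i) (u' i) t) :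
    HasDerivAt (fun t => ∑ i, ‖u t i‖ ^ 2) (2 * (star (u t) ⬝ᵥ u').re) t := by
  refine (HasDerivAt.fun_sum fun i (_ : i ∈ Finset.univ) => (hu i).norm_sq).congr_deriv ?_
  rw [dotProduct, Complex.re_sum, Finset.mul_sum]
  refine Finset.sum_congr rfl fun i _ => ?_
  rw [Complex.inner, Pi.star_apply, Complex.star_def, mul_comm (u' i)]

/-- The orbit `t ↦ exp(t • (-M)) v` of the matrix semigroup solves `u' = -M u`, coordinatewise.
The derivative of the exponential is taken in the `L^∞` operator normed algebra structure on
`Matrix ι ι ℂ` (scoped instance `Matrix.Norms.Operator`), whose topology is the product one. -/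
private theorem squareRootStrip_hasDerivAt_orbit {ι : Type*} [Fintype ι] [DecidableEq ι]
    (M : Matrix ι ι ℂ) (v : ι → ℂ) (t : ℝ) (i : ι) :
    HasDerivAt (fun t : ℝ => (NormedSpace.exp (t • (-M)) *ᵥ v) i)
      ((-(M *ᵥ (NormedSpace.exp (t • (-M)) *ᵥ v))) i) t := by
  have hU : HasDerivAt (fun t : ℝ => NormedSpace.exp (t • (-M)))
      ((-M) * NormedSpace.exp (t • (-M))) t := by
    open scoped Matrix.Norms.Operator in exact hasDerivAt_exp_smul_const' (𝕂 := ℝ) (-M) t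
  have hentry : ∀ j, HasDerivAt (fun t : ℝ => NormedSpace.exp (t • (-M)) i j)
      (((-M) * NormedSpace.exp (t • (-M))) i j) t :=
    fun j => hasDerivAt_pi.1 (hasDerivAt_pi.1 hU i) j
  change HasDerivAt (fun t : ℝ => ∑ j, NormedSpace.exp (t • (-M)) i j * v j) _ t
  refine (HasDerivAt.fun_sum fun j (_ : j ∈ Finset.univ) =>
    (hentry j).mul_const (v j)).congr_deriv ?_
  change (((-M) * NormedSpace.exp (t • (-M))) *ᵥ v) i = _
  rw [← Matrix.mulVec_mulVec, Matrix.neg_mulVec]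

/-- The energy estimate along an arbitrary solution of `u' = -M u`: if the quadratic form of `M`
has real part `≥ -c²`, then `Σ_i ‖u s i‖² ≤ e^{2c² s} Σ_i ‖u 0 i‖²` for `s ≥ 0`. -/
private theorem squareRootStrip_orbit_bound {ι : Type*} [Fintype ι] (M : Matrix ι ι ℂ) (c : ℝ)
    (hM : ∀ v : ι → ℂ, -(c ^ 2 * ∑ i, ‖v i‖ ^ 2) ≤ (∑ i, star (v i) * M.mulVec v i).re)
    (u : ℝ → ι → ℂ) (hu : ∀ t i, HasDerivAt (fun t => u t i) ((-(M *ᵥ u t)) i) t)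
    (s : ℝ) (hs : 0 ≤ s) :
    ∑ i, ‖u s i‖ ^ 2 ≤ Real.exp (2 * c ^ 2 * s) * ∑ i, ‖u 0 i‖ ^ 2 := by
  have hE : ∀ t, HasDerivAt (fun t => ∑ i, ‖u t i‖ ^ 2)
      (2 * (star (u t) ⬝ᵥ (-(M *ᵥ u t))).re) t :=
    fun t => squareRootStrip_hasDerivAt_energy u (-(M *ᵥ u t)) t (hu t)
  have hE' : ∀ t, 2 * (star (u t) ⬝ᵥ (-(M *ᵥ u t))).re ≤ 2 * c ^ 2 * ∑ i, ‖u t i‖ ^ 2 := by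
    intro t
    have h := hM (u t)
    have hsum : (∑ i, star (u t i) * M.mulVec (u t) i) = star (u t) ⬝ᵥ (M *ᵥ u t) := rfl
    rw [hsum] at h
    rw [dotProduct_neg, Complex.neg_re]
    linarith
  exact squareRootStrip_gronwall (fun t => ∑ i, ‖u t i‖ ^ 2)
    (fun t => 2 * (star (u t) ⬝ᵥ (-(M *ᵥ u t))).re) (2 * c ^ 2) hE hE' s hs

/-- **The square-root strip** (registered stub `stub_squareRootStrip` of line `Sketch`; card
square-root-dissipativity-strips, the Lumer–Phillips step consuming `stub_squareDissipativity`):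
a lower bound `-c²` on the real part of the quadratic form of `M` gives quasi-contractivity of the
semigroup, `Σ_i ‖(e^{-sM} v) i‖² ≤ e^{2c² s} Σ_i ‖v i‖²` for `s ≥ 0`.  Energy method: along
`u(t) = e^{-tM} v` one has `d/dt ‖u‖² = -2 Re⟨u, Mu⟩ ≤ 2c² ‖u‖²`, so `e^{-2c² t} ‖u(t)‖²` is
antitone. -/
theorem stub_squareRootStrip :
    ∀ (ι : Type) [Fintype ι] [DecidableEq ι] (M : Matrix ι ι ℂ) (c s : ℝ), 0 ≤ s →
      (∀ v : ι → ℂ, -(c ^ 2 * ∑ i, ‖v i‖ ^ 2) ≤ (∑ i, star (v i) * M.mulVec v i).re) →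
      ∀ v : ι → ℂ,
        ∑ i, ‖(NormedSpace.exp (-(s : ℂ) • M)).mulVec v i‖ ^ 2 ≤
          Real.exp (2 * c ^ 2 * s) * ∑ i, ‖v i‖ ^ 2 := by
  intro ι _ _ M c s hs hM v
  -- the energy estimate along the orbit `t ↦ exp(t • (-M)) v`, from `t = 0` to `t = s`
  have hb : ∑ i, ‖(NormedSpace.exp (s • (-M)) *ᵥ v) i‖ ^ 2 ≤
      Real.exp (2 * c ^ 2 * s) * ∑ i, ‖(NormedSpace.exp ((0 : ℝ) • (-M)) *ᵥ v) i‖ ^ 2 :=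
    squareRootStrip_orbit_bound M c hM (fun t => NormedSpace.exp (t • (-M)) *ᵥ v)
      (fun t i => squareRootStrip_hasDerivAt_orbit M v t i) s hs
  rw [zero_smul, NormedSpace.exp_zero, Matrix.one_mulVec] at hb
  -- the real ray `s • (-M)` is the complex scalar multiple `(-(s : ℂ)) • M`
  have hsM : NormedSpace.exp (-(s : ℂ) • M) = NormedSpace.exp (s • (-M)) := by
    congr 1
    ext i j
    simp [Matrix.smul_apply, Complex.real_smul]
  rw [hsM]
  exact hb

end Summit.QuantumFields.QCD.Cruxes.InterleavedHeatSliceFlow.Sketch
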